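/-
Copyright (c) 2026 the pub-hodgecm-mathlib formalisation cell (harness21).  Prover seat hodgecm-mathlib-K2E5-p16 (g4): Track B «K2-LIT»,
hLiu418 = stmt-HodgeConjecture-24832, ROAD Φ organ Φ6b-4 (dealer K2E5-plan (g5) 2026-09-04T06:55:23Z, the CONSUMER file #41's arch side reads):
the continuation `Ξ(g, h; ·, β)` of `ξ(g, h; ·, β)` and its growth in `h`, locally uniformly in `α`; 2026-09-04.
-/
import Summits.HodgeConjecture.HodgeConjecture.Theorems.K2LiuHermTwoEtaHolomorphy               -- ★ p858099 (this seat): `Ξ` entire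
import Summits.HodgeConjecture.HodgeConjecture.Theorems.K2LiuHermTwoEtaGrowth                   -- ★∕📤 p858124 (this seat): growth of `η`
import HarnessLib

/-!
# Crux `HLiu418`, ROAD Φ, organ Φ6b-4: THE CONTINUATION `Ξ(g, h; α, β)` OF `ξ(g, h; α, β)` IN `α` AND ITS GROWTH IN `h`
# [Shimura1982, Thm 3.1, the `h > 0` half, Case II, m = κ = 2]

Cell `hodgecm-mathlib`, crux item hLiu418 = `stmt-HodgeConjecture-24832`, route of record `HCCMUnconditional`; squad K2, LEAD F0P6-plan (g12), co-dealer
K2E5-plan (g5), prover K2E5-p16 (g4).  THEOREMS ONLY; lane `--supports stmt-HodgeConjecture-24832 --as helper`.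

`Ξ(g, h; α, β) := 4π⁴ · e^{iπ(β−α)} · Γ₂(α)⁻¹ · Γ₂(β)⁻¹ · η(2g, πh; α, β)` (written out; no `def`).
* `xiTwo_continuation` — THE DEALER'S LITERAL SHAPE: for `g, h > 0`, `re β > 1`:
  `∃ Ξ : ℂ → ℂ, DifferentiableOn ℂ Ξ univ ∧ ∀ α, 3 < re α → Ξ α = ξ(g, h; α, β)` (★ `xiTwo_eq_entire`).
* `norm_xiEtaRhs_le` — GROWTH IN `h`, LOCALLY UNIFORM IN `α`: for `g > 0`, `re β > 1` and a compact `K ⊂ ℂ` there are `C, N, N′ ≥ 0` with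
  `|Ξ(g, h; α, β)| ≤ C · e^{−2π Re tr(hg)} · (1 + tr h)^N · (1 + det(h)^{−N′})` for every `h > 0` and `α ∈ K`
  (★ `norm_etaTwo_le` at `(2g, πh)` + continuity of `e^{iπ(β−α)} Γ₂(α)⁻¹` on `K`).  With `h` in a lattice (`det h ≥ δ_L`) and coefficients
  of polynomial growth this is the absolute and locally uniform convergence of the continued Fourier expansion (organ Φ6b-5).
HONEST LABEL.  Count-neutral helper of the K2_Liu road; it pays no socket by itself: `HC_CM` is proved only modulo the 7 printed citations
(2 remaining named inputs: hLiu418 = `stmt-HodgeConjecture-24832`, h413 = `stmt-HodgeConjecture-24833`) until rung 0 closes.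
-/

set_option autoImplicit false
-- the mandated namespace repeats the single-problem summit's segment (`HodgeConjecture.HodgeConjecture`)
set_option linter.dupNamespace false

noncomputable section

open Complex MeasureTheory Set
open scoped ComplexOrder ComplexConjugate

namespace Summit.HodgeConjecture.HodgeConjecture.Cruxes.HLiu418.K2LiuHermTwoXiContinuation

open Summit.HodgeConjecture.HodgeConjecture.Cruxes.HLiu418.K2LiuHermTwoGammaDefs
open Summit.HodgeConjecture.HodgeConjecture.Cruxes.HLiu418.K2LiuHermTwoConfluentXiDefs
open Summit.HodgeConjecture.HodgeConjecture.Cruxes.HLiu418.K2LiuHermTwoEtaDefs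
open Summit.HodgeConjecture.HodgeConjecture.Cruxes.HLiu418.K2LiuHermTwoEtaConvergence
open Summit.HodgeConjecture.HodgeConjecture.Cruxes.HLiu418.K2LiuHermTwoXiEtaIdentity
open Summit.HodgeConjecture.HodgeConjecture.Cruxes.HLiu418.K2LiuHermTwoEtaHolomorphy
open Summit.HodgeConjecture.HodgeConjecture.Cruxes.HLiu418.K2LiuHermTwoEtaGrowth

/-! ## The continuation statement #41's archimedean side consumes -/

/-- **SHIMURA'S CONTINUATION `Ξ(g, h; ·, β)` OF `ξ(g, h; ·, β)`** (`g, h > 0`, `re β > 1`), in the dealer's literal shape: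
there is `Ξ : ℂ → ℂ`, complex-differentiable on `univ`, with `Ξ(α) = ξ(g, h; α, β)` whenever `re α > 3`. -/
theorem xiTwo_continuation {g h : Matrix (Fin 2) (Fin 2) ℂ} (hg : g.PosDef) (hh : h.PosDef) {β : ℂ} (hβ : 1 < β.re) :
    ∃ Ξ : ℂ → ℂ, DifferentiableOn ℂ Ξ univ ∧ ∀ α : ℂ, 3 < α.re → Ξ α = xiTwo g h α β := by
  obtain ⟨A, hA, hAeq⟩ := xiTwo_eq_entire hg hh hβ
  exact ⟨A, hA.differentiableOn, fun α hα => (hAeq α hα).symm⟩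

/-- The same with `Ξ` named: `Ξ(α) = 4π⁴ e^{iπ(β−α)} Γ₂(α)⁻¹ Γ₂(β)⁻¹ η(2g, πh; α, β)` is entire and agrees with `ξ` on `re α > 3`. -/
theorem xiTwo_continuation_explicit {g h : Matrix (Fin 2) (Fin 2) ℂ} (hg : g.PosDef) (hh : h.PosDef) {β : ℂ} (hβ : 1 < β.re) :
    DifferentiableOn ℂ (fun α : ℂ => ((4 * Real.pi ^ 4 : ℝ) : ℂ) * cexp ((Real.pi * I) * (β - α)) * (hermTwoGamma α)⁻¹ *
        (hermTwoGamma β)⁻¹ * etaTwo ((2 : ℂ) • g) ((Real.pi : ℂ) • h) α β) univ ∧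
      ∀ α : ℂ, 3 < α.re → ((4 * Real.pi ^ 4 : ℝ) : ℂ) * cexp ((Real.pi * I) * (β - α)) * (hermTwoGamma α)⁻¹ *
        (hermTwoGamma β)⁻¹ * etaTwo ((2 : ℂ) • g) ((Real.pi : ℂ) • h) α β = xiTwo g h α β :=
  ⟨(differentiable_xiEtaRhs hg hh hβ).differentiableOn, fun _ hα => (xiTwo_eq_etaTwo hg hh hα hβ).symm⟩

/-! ## Growth of `Ξ` in `h`, locally uniformly in `α` -/

/-- The prefactor `4π⁴ e^{iπ(β−α)} Γ₂(α)⁻¹ Γ₂(β)⁻¹` is continuous in `α`. -/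
theorem continuous_xiEtaPrefactor (β : ℂ) :
    Continuous (fun α : ℂ => ((4 * Real.pi ^ 4 : ℝ) : ℂ) * cexp ((Real.pi * I) * (β - α)) * (hermTwoGamma α)⁻¹ * (hermTwoGamma β)⁻¹) :=
  (((((differentiable_const _).mul ((((differentiable_const β).sub differentiable_id).const_mul _).cexp)).mul
    differentiable_hermTwoGamma_inv).mul (differentiable_const _))).continuous

/-- **GROWTH OF `Ξ(g, h; α, β)` IN `h`, LOCALLY UNIFORMLY IN `α`**: for `g > 0`, `re β > 1` and compact `K ⊂ ℂ` there are `C, N, N′ ≥ 0`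
such that for every positive definite `h` and every `α ∈ K`,
  `|4π⁴ e^{iπ(β−α)} Γ₂(α)⁻¹ Γ₂(β)⁻¹ η(2g, πh; α, β)| ≤ C · e^{−2π Re tr(hg)} · (1 + tr h)^N · (1 + det(h)^{−N′})`. -/
theorem norm_xiEtaRhs_le {g : Matrix (Fin 2) (Fin 2) ℂ} (hg : g.PosDef) {β : ℂ} (hβ : 1 < β.re) {K : Set ℂ} (hK : IsCompact K) :
    ∃ C N N' : ℝ, 0 ≤ C ∧ 0 ≤ N ∧ 0 ≤ N' ∧ ∀ h : Matrix (Fin 2) (Fin 2) ℂ, h.PosDef → ∀ α ∈ K,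
      ‖((4 * Real.pi ^ 4 : ℝ) : ℂ) * cexp ((Real.pi * I) * (β - α)) * (hermTwoGamma α)⁻¹ * (hermTwoGamma β)⁻¹ *
          etaTwo ((2 : ℂ) • g) ((Real.pi : ℂ) • h) α β‖ ≤
        C * Real.exp (-(2 * Real.pi * ((h * g).trace).re)) * (1 + ((h 0 0).re + (h 1 1).re)) ^ N *
          (1 + ((h 0 0).re * (h 1 1).re - normSq (h 0 1)) ^ (-N')) := by
  -- `K` lies in a strip `|re α| ≤ R`
  obtain ⟨R₀, hR₀⟩ := hK.isBounded.subset_closedBall 0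
  set R : ℝ := |R₀| with hR
  have hstrip : ∀ α ∈ K, -R ≤ α.re ∧ α.re ≤ R := fun α hα =>
    abs_le.mp (((Complex.abs_re_le_norm α).trans (mem_closedBall_zero_iff.mp (hR₀ hα))).trans (le_abs_self R₀))
  -- the prefactor is bounded on `K`
  obtain ⟨M, hM⟩ := hK.exists_bound_of_continuousOn (continuous_xiEtaPrefactor β).continuousOn
  -- the growth of `η` at `(2g, πh)`
  obtain ⟨d, rfl⟩ : ∃ d : ℝ × ℂ × ℝ, hermTwo d = g := ⟨_, hermTwo_eq_of_isHermitian hg.1⟩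
  have hd := (posDef_hermTwo_iff d).mp hg
  have h2 : (2 : ℂ) • hermTwo d = hermTwo ((2 : ℝ) • d) := by rw [hermTwo_smul]; norm_num
  have h2g : (hermTwo ((2 : ℝ) • d)).PosDef := posDef_hermTwo_smul two_pos hg
  obtain ⟨C, hC, hB⟩ := norm_etaTwo_le h2g hβ (a₁ := -R) (a₂ := R) (by linarith [abs_nonneg R₀])
  set N : ℝ := 2 * max (R - 2) 0 with hN
  set N' : ℝ := max (2 - -R) 0 with hN'
  have hN0 : 0 ≤ N := by positivity
  have hN'0 : 0 ≤ N' := le_max_right _ _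
  refine ⟨max M 0 * (C * Real.pi ^ N), N, N', by positivity, hN0, hN'0, fun h hh α hα => ?_⟩
  obtain ⟨e, rfl⟩ : ∃ e : ℝ × ℂ × ℝ, hermTwo e = h := ⟨_, hermTwo_eq_of_isHermitian hh.1⟩
  have heh := (posDef_hermTwo_iff e).mp hh
  have he2 : 0 < e.2.2 := snd_pos_of_cone heh.1 heh.2
  have hδ : 0 < e.1 * e.2.2 - normSq e.2.1 := by linarith [heh.2]
  have hπe : (hermTwo (Real.pi • e)).PosDef := posDef_hermTwo_smul Real.pi_pos hh
  have hη := hB (hermTwo (Real.pi • e)) hπe α (hstrip α hα).1 (hstrip α hα).2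
  simp only [hermTwo_apply_zero_zero, hermTwo_apply_one_one, hermTwo_apply_zero_one, Prod.smul_fst, Prod.smul_snd, smul_eq_mul,
    Complex.real_smul, ofReal_re, trace_hermTwo_mul_hermTwo, map_mul, normSq_ofReal] at hη
  simp only [hermTwo_apply_zero_zero, hermTwo_apply_one_one, hermTwo_apply_zero_one, ofReal_re, trace_hermTwo_mul_hermTwo]
  rw [h2, ← hermTwo_smul, norm_mul]
  -- compare the two right-hand sides
  have hT : Real.pi * e.1 * (2 * d.1) + Real.pi * e.2.2 * (2 * d.2.2) +
      2 * ((Real.pi : ℂ) * e.2.1 * (conj ((2 : ℝ) : ℂ) * conj d.2.1)).re =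
      2 * Real.pi * (e.1 * d.1 + e.2.2 * d.2.2 + 2 * (e.2.1 * conj d.2.1).re) := by
    simp only [Complex.conj_ofReal, Complex.mul_re, Complex.mul_im, Complex.conj_re, Complex.conj_im, Complex.ofReal_re,
      Complex.ofReal_im]
    ring
  have hdet : Real.pi * e.1 * (Real.pi * e.2.2) - Real.pi * Real.pi * normSq e.2.1 = Real.pi ^ 2 * (e.1 * e.2.2 - normSq e.2.1) := by
    ring
  rw [hT, hdet] at hη
  -- the profile factors
  have hπ3 := Real.pi_gt_three
  have hE0 : 0 ≤ e.1 + e.2.2 := by linarith [heh.1]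
  have htr : (1 + (Real.pi * e.1 + Real.pi * e.2.2)) ^ N ≤ Real.pi ^ N * (1 + (e.1 + e.2.2)) ^ N := by
    rw [← Real.mul_rpow Real.pi_pos.le (by linarith)]
    exact Real.rpow_le_rpow (by nlinarith [heh.1]) (by nlinarith) hN0
  have hdt : 1 + (Real.pi ^ 2 * (e.1 * e.2.2 - normSq e.2.1)) ^ (-N') ≤ 1 + (e.1 * e.2.2 - normSq e.2.1) ^ (-N') := by
    rw [Real.mul_rpow (by positivity) hδ.le]
    have h1 : (Real.pi ^ 2) ^ (-N') ≤ 1 := Real.rpow_le_one_of_one_le_of_nonpos (by nlinarith) (by linarith)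
    nlinarith [Real.rpow_nonneg hδ.le (-N')]
  have hP : 0 ≤ Real.pi ^ N * (1 + (e.1 + e.2.2)) ^ N := by positivity
  have hQ : 0 ≤ 1 + (Real.pi ^ 2 * (e.1 * e.2.2 - normSq e.2.1)) ^ (-N') := by
    linarith [Real.rpow_nonneg (show (0 : ℝ) ≤ Real.pi ^ 2 * (e.1 * e.2.2 - normSq e.2.1) by positivity) (-N')]
  have hη' := hη.trans (mul_le_mul_of_nonneg_left (mul_le_mul htr hdt hQ hP)
    (mul_nonneg hC (Real.exp_pos (-(2 * Real.pi * (e.1 * d.1 + e.2.2 * d.2.2 + 2 * (e.2.1 * conj d.2.1).re)))).le))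
  have hpre : ‖((4 * Real.pi ^ 4 : ℝ) : ℂ) * cexp ((Real.pi * I) * (β - α)) * (hermTwoGamma α)⁻¹ * (hermTwoGamma β)⁻¹‖ ≤ max M 0 :=
    (hM α hα).trans (le_max_left _ _)
  calc ‖((4 * Real.pi ^ 4 : ℝ) : ℂ) * cexp ((Real.pi * I) * (β - α)) * (hermTwoGamma α)⁻¹ * (hermTwoGamma β)⁻¹‖ *
        ‖etaTwo (hermTwo ((2 : ℝ) • d)) (hermTwo (Real.pi • e)) α β‖
      ≤ max M 0 * (C * Real.exp (-(2 * Real.pi * (e.1 * d.1 + e.2.2 * d.2.2 + 2 * (e.2.1 * conj d.2.1).re))) *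
          (Real.pi ^ N * (1 + (e.1 + e.2.2)) ^ N * (1 + (e.1 * e.2.2 - normSq e.2.1) ^ (-N')))) :=
        mul_le_mul hpre hη' (norm_nonneg _) (le_max_right _ _)
    _ = _ := by ring

end Summit.HodgeConjecture.HodgeConjecture.Cruxes.HLiu418.K2LiuHermTwoXiContinuation

end
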